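import Mathlib.Probability.Distributions.Gaussian.Fernique
import Literature.MathematicalPhysics.KineticTheory.Hilbert6LinearizedBoltzmann
import Literature.Analysis.UnboundedOperators.LinearizedBoltzmannProofs
import Literature.Analysis.UnboundedOperators.LinearizedBoltzmannSpectralGapProofs
import HarnessLib

/-!
# The linearised hard-sphere operator on `L²(M dv)`: the self-adjoint realisation with spectral gap (proofs)

Sibling proof file of `Hilbert6LinearizedBoltzmann.lean` (D-0014), next to
`Hilbert6LinearizedBoltzmannProofs.lean` (the kernel), `Hilbert6LinearizedBoltzmannGapProofs.lean`
(the function-level spectral gap) and `Hilbert6LinearizedBoltzmannSymmetryProofs.lean` (symmetry,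
non-positivity). It discharges the named fact
`Literature.MathematicalPhysics.KineticTheory.hardSphereLinearizedOp_selfAdjointRealisation`
(**hilbert6.S19**: in velocity dimension `d ≥ 2` the linearised hard-sphere collision operator
`L` has a self-adjoint, non-positive realisation `A` on `L²(M dv) = Lp ℝ 2 (stdGaussian ℝ^d)`
with core the temperate-growth classes, acting on them as `L`, and `-A` has a spectral gap
`λ > 0` above its ground space at energy `0`, the (finite-dimensional) image of the collision
invariants) as `hardSphereLinearizedOp_selfAdjointRealisation_holds`.

The fact is the conjunction of two results of the prelude
`Literature.Analysis.UnboundedOperators.LinearizedBoltzmann`, recorded there as named facts and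
meanwhile discharged in its proof files:

* `exists_isSelfAdjoint_hasCore` — the self-adjoint non-positive realisation with core the
  temperate-growth classes (Cercignani–Illner–Pulvirenti 1994, §7.2, Theorem 7.2.1, p. 197:
  *the linearized collision operator … is self-adjoint and nonpositive in `L²`, with a fivefold
  null eigenspace spanned by `M^{1/2} ψ_α` where `ψ_α` are the collision invariants*; the
  Hilbert–Grad splitting `L = K - ν(|ξ|) I`, (2.14)–(2.16), p. 197, `K` bounded), discharged as
  `exists_isSelfAdjoint_hasCore_holds` in `LinearizedBoltzmannProofs` (Grad's `A = -ν + K` on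
  `{f | ν f ∈ L²}`, `LinearizedBoltzmannOperator`/`…SelfAdjoint`/`…Action`);
* `le_neg_maxwellianInner_hardSphereLinearizedOp_of_orthogonal` — the spectral gap of `-L` on
  the `M`-orthogonal complement of the collision invariants, at function level (CIP 1994 §7.2,
  Theorem 7.2.5, p. 201: *the spectrum of `L` is made up of a discrete and an essential spectrum:
  the former is contained in `(-ν₀, 0]`, the latter coincides with `(-∞, -ν₀]`*, by Weyl's
  theorem, `K` being compact, Theorem 7.2.4, p. 199; Grad 1963; explicit constant:
  Baranger–Mouhot 2005, Thm 1.1), discharged as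
  `le_neg_maxwellianInner_hardSphereLinearizedOp_of_orthogonal_holds` in
  `LinearizedBoltzmannSpectralGapProofs` (fibre reduction + pseudo-Maxwellian polynomial gap).

This file proves the **glue** `hardSphereLinearizedOp_selfAdjointRealisation_of` (the
statement-file fact from the two prelude facts taken as explicit hypotheses; general velocity
space: `exists_selfAdjointRealisation_hasSpectralGapAbove`) and feeds it the two discharges. No
named fact is introduced.

## The argument

Let `A` be the self-adjoint realisation with core `S` (the temperate-growth classes), `V` the
image of the collision invariants in `L²(M)` and `P` the orthogonal projection onto `V`.

* `-A` is self-adjoint (`isSelfAdjoint_neg_linearPMap`: `(-A)† = -A†` for densely defined `A`;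
  Reed–Simon I §VIII.2).
* `V` is finite-dimensional (`finiteDimensional_aeEqClasses_collisionInvariants`: it is contained
  in the range of the linear parametrisation `(a, c, b) ↦ [a + ⟪b, v⟫ + c |v|²]`, collision
  invariants being exactly these quadratics, `mem_collisionInvariants_iff`, and polynomials being
  in `L²` of a Gaussian measure, Fernique / `IsGaussian.memLp_id`), hence closed, so `P` exists;
  `V ≠ ⊥` (it contains the class of `1`); `V ≤ ker A` because collision invariants are annihilated
  by every linearised collision operator (`linearizedCollisionOp_eq_zero_of_isCollisionInvariant`)
  and `A` acts as `L` on `S ⊇ V`.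
* Gap on `dom A ∩ Vᗮ`: the condition `λ ‖x - P x‖² ≤ ⟪x - P x, -y⟫` is closed in `(x, y)` and
  holds on the graph of `A|S` — for `x ∈ S`, `x - P x ∈ S ∩ Vᗮ` and `A (P x) = 0`, so this is the
  function-level gap applied to a temperate-growth representative of `x - P x`, the `L²(M)`
  pairings of classes being the Maxwellian pairings of representatives
  (`inner_eq_maxwellianInner`). Since `S` is a core, `Γ(A) ⊆ closure Γ(A|S)`
  (`LinearPMap.HasCore.graph_subset_closure_graph_domRestrict`), so the condition holds on
  `Γ(A)`; for `x ⊥ V` one has `P x = 0`. (This is the standard passage of form bounds to the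
  closure, Kato, *Perturbation Theory for Linear Operators*, V §3.10, Problem 3.7; CIP 1994 use
  it implicitly in passing from (1.10), p. 192, to Theorem 7.2.1.)

## References

* C. Cercignani, R. Illner, M. Pulvirenti, *The Mathematical Theory of Dilute Gases*, Applied
  Mathematical Sciences 106, Springer (1994): §7.1 (1.8)–(1.10), p. 192; §7.2 Theorem 7.2.1 and
  (2.14)–(2.16), p. 197; Theorems 7.2.2–7.2.4, pp. 197–199; Theorem 7.2.5, p. 201.
* H. Grad, *Asymptotic theory of the Boltzmann equation II*, Rarefied Gas Dynamics I (1963) 26–59.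
* C. Baranger, C. Mouhot, Rev. Mat. Iberoam. 21 (2005) 819–841, Theorem 1.1.
* T. Kato, *Perturbation Theory for Linear Operators*, V §3.10.
-/

open MeasureTheory ProbabilityTheory Module Filter
open scoped InnerProductSpace ENNReal

namespace Literature.MathematicalPhysics.KineticTheory

noncomputable section

/-! ### The negative of a self-adjoint partially defined operator -/

section NegSelfAdjoint

variable {𝕜 F : Type*} [RCLike 𝕜] [NormedAddCommGroup F] [InnerProductSpace 𝕜 F] [CompleteSpace F]

/-- If a partially defined operator `A` on a Hilbert space is self-adjoint (Mathlib's
`IsSelfAdjoint` for `LinearPMap.instStar`, i.e. `A† = A`), then so is `-A`: `-A` is symmetric,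
hence `-A ≤ (-A)†`, and `dom (-A)† ≤ dom A† = dom A` because `⟪-(-A)† y, x⟫ = ⟪y, A x⟫` on
`dom A` (Reed–Simon I, §VIII.2; `(cA)† = conj c · A†` for `c ≠ 0`). [folklore] -/
theorem isSelfAdjoint_neg_linearPMap {A : F →ₗ.[𝕜] F} (hA : IsSelfAdjoint A) :
    IsSelfAdjoint (-A) := by
  have hdense : Dense ((-A).domain : Set F) := hA.dense_domain
  have hsymm : A.IsFormalAdjoint A := hA.isSymmetric_linearPMap
  have hsymm' : (-A).IsFormalAdjoint (-A) := fun x y => by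
    rw [LinearPMap.neg_apply, LinearPMap.neg_apply, inner_neg_left, inner_neg_right, hsymm x y]
  have hle : -A ≤ (-A).adjoint := hsymm'.le_adjoint hdense
  have hdom : (-A).adjoint.domain ≤ (-A).domain := by
    intro y hy
    have hmem : y ∈ A.adjoint.domain := by
      refine LinearPMap.mem_adjoint_domain_of_exists y ⟨-((-A).adjoint ⟨y, hy⟩), fun x => ?_⟩
      have h := LinearPMap.adjoint_isFormalAdjoint hdense ⟨y, hy⟩ x
      rw [inner_neg_left, h, LinearPMap.neg_apply, inner_neg_right, neg_neg]
    rwa [LinearPMap.isSelfAdjoint_def.mp hA] at hmem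
  rw [LinearPMap.isSelfAdjoint_def]
  exact (LinearPMap.eq_of_le_of_domain_eq hle (le_antisymm hle.1 hdom)).symm

end NegSelfAdjoint

/-! ### Classes in `L²(M dv)` versus functions -/

section MaxwellianL2

open Literature.Analysis.UnboundedOperators

/-- `aeEqClasses μ` is monotone in the submodule of functions. [folklore] -/
theorem aeEqClasses_mono {α : Type*} [MeasurableSpace α] (μ : Measure α)
    {W₁ W₂ : Submodule ℝ (α → ℝ)} (h : W₁ ≤ W₂) : aeEqClasses μ W₁ ≤ aeEqClasses μ W₂ :=
  fun _ ⟨g, hg, hfg⟩ => ⟨g, h hg, hfg⟩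

variable {E : Type*} [NormedAddCommGroup E] [InnerProductSpace ℝ E] [FiniteDimensional ℝ E]
  [MeasurableSpace E] [BorelSpace E]

omit [BorelSpace E] in
/-- The `L²(M dv)` inner product of two classes is the Maxwellian pairing
`⟪g₁, g₂⟫_M = ∫ g₁ g₂ dM` of any two representatives (CIP 1994 §7.1 (1.8), p. 192). [cite: CIP1994, §7.1 (1.8) p. 192] -/
theorem inner_eq_maxwellianInner {f₁ f₂ : Lp ℝ 2 (stdGaussian E)} {g₁ g₂ : E → ℝ}
    (h₁ : (f₁ : E → ℝ) =ᵐ[stdGaussian E] g₁) (h₂ : (f₂ : E → ℝ) =ᵐ[stdGaussian E] g₂) :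
    ⟪f₁, f₂⟫_ℝ = maxwellianInner g₁ g₂ := by
  rw [MeasureTheory.L2.inner_def, maxwellianInner]
  refine integral_congr_ae ?_
  filter_upwards [h₁, h₂] with v hv₁ hv₂
  rw [hv₁, hv₂]
  exact Real.inner_apply _ _

/-- Collision invariants `a + ⟪b, v⟫ + c |v|²` are square integrable for the Maxwellian
`M dv = stdGaussian E` (a Gaussian measure has moments of all orders, Fernique; CIP 1994 §7.2,
the null eigenfunctions `M^{1/2} ψ_α ∈ L²`, Thm 7.2.1 p. 197). [cite: CIP1994, §7.2 Thm 7.2.1 p. 197] -/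
theorem memLp_two_of_mem_collisionInvariants {φ : E → ℝ} (hφ : φ ∈ collisionInvariants E) :
    MemLp φ 2 (stdGaussian E) := by
  obtain ⟨a, c, b, rfl⟩ := mem_collisionInvariants_iff.mp hφ
  have h₁ : MemLp (fun _ : E => a) 2 (stdGaussian E) := memLp_const a
  have h₂ : MemLp (fun v : E => ⟪b, v⟫_ℝ) 2 (stdGaussian E) :=
    (IsGaussian.memLp_two_id (μ := stdGaussian E)).const_inner b
  have h₄ : MemLp (fun v : E => ‖v‖ ^ 2) 2 (stdGaussian E) := by
    have hmeas : AEStronglyMeasurable (fun v : E => ‖v‖ ^ 2) (stdGaussian E) :=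
      Continuous.aestronglyMeasurable (by fun_prop)
    rw [memLp_two_iff_integrable_sq hmeas]
    have hi := (IsGaussian.memLp_id (stdGaussian E) ((4 : ℕ) : ℝ≥0∞)
      (ENNReal.natCast_ne_top 4)).integrable_norm_pow (by norm_num)
    refine hi.congr (ae_of_all _ fun v => ?_)
    simp only [id_eq]
    ring
  have h₃ : MemLp (fun v : E => c * ‖v‖ ^ 2) 2 (stdGaussian E) := h₄.const_mul c
  exact (h₁.add h₂).add h₃

/-- The image `aeEqClasses M (collisionInvariants E)` of the collision invariants in `L²(M dv)`
is finite-dimensional: it is contained in the range of the linear parametrisation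
`(a, c, b) ↦ [a + ⟪b, ·⟫ + c |·|²]` (CIP 1994 §7.2 Thm 7.2.1, p. 197: a `(d+2)`-fold null
eigenspace; §3.1 Thm 3.1.1). [cite: CIP1994, §7.2 Thm 7.2.1 p. 197] -/
theorem finiteDimensional_aeEqClasses_collisionInvariants :
    FiniteDimensional ℝ (aeEqClasses (stdGaussian E) (collisionInvariants E)) := by
  have hq : ∀ p : ℝ × ℝ × E,
      (fun v : E => p.1 + ⟪p.2.2, v⟫_ℝ + p.2.1 * ‖v‖ ^ 2) ∈ collisionInvariants E := fun p =>
    mem_collisionInvariants_iff.mpr ⟨p.1, p.2.1, p.2.2, rfl⟩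
  let Ψ : (ℝ × ℝ × E) →ₗ[ℝ] Lp ℝ 2 (stdGaussian E) :=
    { toFun := fun p => (memLp_two_of_mem_collisionInvariants (hq p)).toLp _
      map_add' := fun p q => by
        ext1
        refine (MemLp.coeFn_toLp _).trans (EventuallyEq.trans ?_ (Lp.coeFn_add _ _).symm)
        filter_upwards [MemLp.coeFn_toLp (memLp_two_of_mem_collisionInvariants (hq p)),
          MemLp.coeFn_toLp (memLp_two_of_mem_collisionInvariants (hq q))] with v h₃ h₄
        rw [Pi.add_apply, h₃, h₄]
        simp only [Prod.fst_add, Prod.snd_add, inner_add_left]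
        ring
      map_smul' := fun r p => by
        ext1
        refine (MemLp.coeFn_toLp _).trans (EventuallyEq.trans ?_ (Lp.coeFn_smul _ _).symm)
        filter_upwards [MemLp.coeFn_toLp (memLp_two_of_mem_collisionInvariants (hq p))]
          with v h₃
        rw [Pi.smul_apply, h₃]
        simp only [RingHom.id_apply, Prod.smul_fst, Prod.smul_snd, smul_eq_mul,
          real_inner_smul_left]
        ring }
  refine Submodule.finiteDimensional_of_le (S₂ := LinearMap.range Ψ) ?_
  rintro f ⟨φ, hφ, hfφ⟩
  obtain ⟨a, c, b, rfl⟩ := mem_collisionInvariants_iff.mp hφ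
  refine LinearMap.mem_range.mpr ⟨(a, c, b), ?_⟩
  have hΨ : Ψ (a, c, b) = (memLp_two_of_mem_collisionInvariants (hq (a, c, b))).toLp _ := rfl
  rw [hΨ]
  ext1
  exact (MemLp.coeFn_toLp _).trans hfφ.symm

/-- The image of the collision invariants in `L²(M dv)` is non-trivial: it contains the class
of the constant function `1`, which is non-zero since `M dv` is a probability measure
(CIP 1994 §7.2 Thm 7.2.1, p. 197, `ψ₀ = 1`). [cite: CIP1994, §7.2 Thm 7.2.1 p. 197] -/
theorem aeEqClasses_collisionInvariants_ne_bot :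
    aeEqClasses (stdGaussian E) (collisionInvariants E) ≠ ⊥ := by
  intro h
  have h1 : (memLp_const (1 : ℝ)).toLp (fun _ : E => (1 : ℝ)) ∈
      aeEqClasses (stdGaussian E) (collisionInvariants E) :=
    ⟨fun _ => 1, Submodule.subset_span (Or.inl (Or.inl rfl)), MemLp.coeFn_toLp _⟩
  rw [h, Submodule.mem_bot, Lp.eq_zero_iff_ae_eq_zero] at h1
  have h2 : ∀ᵐ _ ∂(stdGaussian E), False := by
    filter_upwards [h1, MemLp.coeFn_toLp (memLp_const (1 : ℝ) (μ := stdGaussian E) (p := 2))]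
      with v hv hv'
    rw [hv'] at hv
    simp at hv
  obtain ⟨_, h3⟩ := h2.exists
  exact h3

/-! ### The reduction -/

/-- **Glue, general velocity space.** From the two prelude facts — the self-adjoint
non-positive realisation `A` of the linearised hard-sphere operator with core the
temperate-growth classes (`exists_isSelfAdjoint_hasCore`; CIP 1994 §7.2 Thm 7.2.1, p. 197) and
the function-level spectral gap of `-L` on the `M`-orthogonal complement of the collision
invariants (`le_neg_maxwellianInner_hardSphereLinearizedOp_of_orthogonal`; CIP 1994 §7.2
Thm 7.2.5, p. 201; Baranger–Mouhot 2005 Thm 1.1) — it follows that `-A` has the spectral gap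
above its ground space `aeEqClasses M (collisionInvariants E)` at energy `0`
(`LinearPMap.HasSpectralGapAbove`): the form bound passes from the core to `dom A` because it is
a closed condition on the graph and `Γ(A) ⊆ closure Γ(A|S)` (Kato V §3.10, Problem 3.7).
[cite: CIP1994, §7.2 Thm 7.2.1 p. 197 and Thm 7.2.5 p. 201] -/
theorem exists_selfAdjointRealisation_hasSpectralGapAbove
    (h₁ : exists_isSelfAdjoint_hasCore (E := E))
    (h₂ : le_neg_maxwellianInner_hardSphereLinearizedOp_of_orthogonal (E := E))
    (hE : 2 ≤ finrank ℝ E) :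
    ∃ (S : Submodule ℝ (Lp ℝ 2 (stdGaussian E)))
      (A : Lp ℝ 2 (stdGaussian E) →ₗ.[ℝ] Lp ℝ 2 (stdGaussian E)) (lam : ℝ),
      0 < lam ∧ IsSelfAdjoint A ∧ (-A).IsPositive ∧ A.HasCore S ∧
      S = aeEqClasses (stdGaussian E) (temperateGrowth E) ∧
      (∀ (f : A.domain) (g : E → ℝ), g ∈ temperateGrowth E →
        ((f : Lp ℝ 2 (stdGaussian E)) : E → ℝ) =ᵐ[stdGaussian E] g →
        ((A f : Lp ℝ 2 (stdGaussian E)) : E → ℝ) =ᵐ[stdGaussian E]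
          hardSphereLinearizedOp g) ∧
      (-A).HasSpectralGapAbove (aeEqClasses (stdGaussian E) (collisionInvariants E)) 0 lam := by
  obtain ⟨S, A, hA, hpos, hcore, hS, hact⟩ := h₁ hE
  obtain ⟨lam, hlam, hgap⟩ := h₂ hE
  have hSeq : S = aeEqClasses (stdGaussian E) (temperateGrowth E) := SetLike.ext hS
  -- `A` kills the classes of collision invariants
  have hker : ∀ (φ : E → ℝ) (hφ : φ ∈ collisionInvariants E) (f : Lp ℝ 2 (stdGaussian E))
      (hf : (f : E → ℝ) =ᵐ[stdGaussian E] φ) (hfD : f ∈ A.domain), A ⟨f, hfD⟩ = 0 := by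
    intro φ hφ f hf hfD
    rw [Lp.eq_zero_iff_ae_eq_zero]
    have hL0 : hardSphereLinearizedOp φ = 0 :=
      linearizedCollisionOp_eq_zero_of_isCollisionInvariant _
        (isCollisionInvariant_of_mem_collisionInvariants hφ)
    have h := hact ⟨f, hfD⟩ φ (collisionInvariants_le_temperateGrowth hφ) hf
    rwa [hL0] at h
  refine ⟨S, A, lam, hlam, hA, hpos, hcore, hSeq, hact, isSelfAdjoint_neg_linearPMap hA,
    hpos.1, ((LinearPMap.isPositive_iff_isBoundedBelowOn_top _).mp hpos).2,
    aeEqClasses_collisionInvariants_ne_bot, ?_, hlam, ?_⟩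
  · -- the collision invariants are ground states of `-A`
    rintro f ⟨φ, hφ, hfφ⟩
    have hfD : f ∈ A.domain :=
      hcore.le_domain ((hS f).2 ⟨φ, collisionInvariants_le_temperateGrowth hφ, hfφ⟩)
    rw [LinearPMap.mem_eigenspace_iff]
    exact ⟨hfD, by simp [LinearPMap.neg_apply, hker φ hφ f hfφ hfD]⟩
  · -- the gap on `dom A ∩ Vᗮ`
    set V := aeEqClasses (stdGaussian E) (collisionInvariants E) with hV
    haveI : FiniteDimensional ℝ V := finiteDimensional_aeEqClasses_collisionInvariants
    -- the gap condition holds on the graph of `A|S`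
    have key : ∀ p ∈ ((A.domRestrict S).graph : Set (Lp ℝ 2 (stdGaussian E) × Lp ℝ 2 (stdGaussian E))),
        lam * ‖p.1 - V.starProjection p.1‖ ^ 2 ≤ ⟪p.1 - V.starProjection p.1, -p.2⟫_ℝ := by
      intro p hp
      obtain ⟨z, hzx, hzy⟩ := (LinearPMap.mem_graph_iff _).1 hp
      have hzS : (z : Lp ℝ 2 (stdGaussian E)) ∈ S := (Submodule.mem_inf.1 z.2).1
      have hzD : (z : Lp ℝ 2 (stdGaussian E)) ∈ A.domain := (Submodule.mem_inf.1 z.2).2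
      have hAz : A.domRestrict S z = A ⟨z, hzD⟩ := LinearPMap.domRestrict_apply rfl
      obtain ⟨g, hg, hzg⟩ := (hS z).1 hzS
      obtain ⟨φ, hφ, hPφ⟩ := V.starProjection_apply_mem (z : Lp ℝ 2 (stdGaussian E))
      have hφt : φ ∈ temperateGrowth E := collisionInvariants_le_temperateGrowth hφ
      have hrep : (((z : Lp ℝ 2 (stdGaussian E)) - V.starProjection z : Lp ℝ 2 (stdGaussian E)) :
          E → ℝ) =ᵐ[stdGaussian E] (g - φ) :=
        (Lp.coeFn_sub _ _).trans (hzg.sub hPφ)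
      have hyD : (z : Lp ℝ 2 (stdGaussian E)) - V.starProjection z ∈ A.domain :=
        hcore.le_domain ((hS _).2 ⟨g - φ, sub_mem hg hφt, hrep⟩)
      have hPD : V.starProjection (z : Lp ℝ 2 (stdGaussian E)) ∈ A.domain :=
        hcore.le_domain ((hS _).2 ⟨φ, hφt, hPφ⟩)
      have hAy : A ⟨_, hyD⟩ = A ⟨z, hzD⟩ := by
        have : (⟨_, hyD⟩ : A.domain) = ⟨z, hzD⟩ - ⟨_, hPD⟩ := rfl
        rw [this, LinearPMap.map_sub, hker φ hφ _ hPφ hPD, sub_zero]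
      have hAyrep : ((A ⟨_, hyD⟩ : Lp ℝ 2 (stdGaussian E)) : E → ℝ) =ᵐ[stdGaussian E]
          hardSphereLinearizedOp (g - φ) :=
        hact ⟨_, hyD⟩ (g - φ) (sub_mem hg hφt) hrep
      have horth : ∀ ψ ∈ collisionInvariants E, maxwellianInner (g - φ) ψ = 0 := by
        intro ψ hψ
        have hψ2 : MemLp ψ 2 (stdGaussian E) := memLp_two_of_mem_collisionInvariants hψ
        have hψV : hψ2.toLp ψ ∈ V := ⟨ψ, hψ, MemLp.coeFn_toLp _⟩
        have h0 : ⟪(z : Lp ℝ 2 (stdGaussian E)) - V.starProjection z, hψ2.toLp ψ⟫_ℝ = 0 :=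
          Submodule.inner_left_of_mem_orthogonal hψV (Submodule.sub_starProjection_mem_orthogonal _)
        rwa [inner_eq_maxwellianInner hrep (MemLp.coeFn_toLp _)] at h0
      have hfun := hgap (g - φ) (sub_mem hg hφt) horth
      rw [← hzx, ← hzy, hAz, ← hAy, inner_neg_right, ← real_inner_self_eq_norm_sq,
        inner_eq_maxwellianInner hrep hrep, inner_eq_maxwellianInner hrep hAyrep]
      exact hfun
    -- it is a closed condition on the graph
    have hclosed : IsClosed {p : Lp ℝ 2 (stdGaussian E) × Lp ℝ 2 (stdGaussian E) |
        lam * ‖p.1 - V.starProjection p.1‖ ^ 2 ≤ ⟪p.1 - V.starProjection p.1, -p.2⟫_ℝ} := by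
      have hc : Continuous fun p : Lp ℝ 2 (stdGaussian E) × Lp ℝ 2 (stdGaussian E) =>
          p.1 - V.starProjection p.1 :=
        continuous_fst.sub (V.starProjection.continuous.comp continuous_fst)
      exact isClosed_le (continuous_const.mul (hc.norm.pow 2)) (hc.inner continuous_snd.neg)
    -- hence it holds on the graph of `A`, the closure of the graph of `A|S`
    intro x hx
    have hxC := (hclosed.closure_subset_iff.2 key)
      (hcore.graph_subset_closure_graph_domRestrict (A.mem_graph ⟨x, x.2⟩))
    have hPx : V.starProjection (x : Lp ℝ 2 (stdGaussian E)) = 0 :=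
      (Submodule.starProjection_apply_eq_zero_iff V).2 hx
    simp only [Set.mem_setOf_eq, hPx, sub_zero] at hxC
    rw [zero_add, RCLike.re_to_real, LinearPMap.neg_apply]
    exact hxC

end MaxwellianL2

/-! ### hilbert6.S19: the statement-file fact -/

variable {d : ℕ}

/-- **Glue for hilbert6.S19** (`hardSphereLinearizedOp_selfAdjointRealisation`). The
statement-file fact — self-adjoint non-positive realisation of the linearised hard-sphere
operator on `L²(M dv)`, `M dv = stdGaussian ℝ^d`, `d ≥ 2`, with core the temperate-growth
classes and spectral gap of `-A` above the image of the collision invariants — follows from the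
prelude facts `exists_isSelfAdjoint_hasCore` (CIP 1994 §7.2 Thm 7.2.1, p. 197) and
`le_neg_maxwellianInner_hardSphereLinearizedOp_of_orthogonal` (CIP 1994 §7.2 Thm 7.2.5, p. 201;
Baranger–Mouhot 2005 Thm 1.1) specialised to `E = ℝ^d` (`finrank ℝ ℝ^d = d`). Feeding it
their discharges gives `hardSphereLinearizedOp_selfAdjointRealisation_holds`.
[cite: CIP1994, §7.2 Thm 7.2.1 p. 197 and Thm 7.2.5 p. 201] -/
theorem hardSphereLinearizedOp_selfAdjointRealisation_of
    (h₁ : Literature.Analysis.UnboundedOperators.exists_isSelfAdjoint_hasCore (E := V d))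
    (h₂ : Literature.Analysis.UnboundedOperators.le_neg_maxwellianInner_hardSphereLinearizedOp_of_orthogonal
      (E := V d)) :
    hardSphereLinearizedOp_selfAdjointRealisation (d := d) := fun hd =>
  exists_selfAdjointRealisation_hasSpectralGapAbove h₁ h₂ (by simpa using hd)

/-- **hilbert6.S19, discharge of `hardSphereLinearizedOp_selfAdjointRealisation`**
(Cercignani–Illner–Pulvirenti 1994, §7.2: Theorem 7.2.1, p. 197 — *the linearized collision
operator `L` is self-adjoint and nonpositive in `L²`, with a `(d+2)`-fold null eigenspace spanned
by `M^{1/2} ψ_α`, `ψ_α` the collision invariants* — together with Theorem 7.2.5, p. 201 — *the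
spectrum of `L` is made up of a discrete and an essential spectrum: the former is contained in
`(-ν₀, 0]`, the latter coincides with `(-∞, -ν₀]`* — whence `-L ≥ λ > 0` on the orthogonal
complement of the null space; printed for `d = 3` in the flat picture `h = M^{1/2} g`, proved
here for every `d ≥ 2` in the unitarily equivalent weighted picture `L²(M dv)`). In velocity
dimension `d ≥ 2` the linearised hard-sphere operator has a self-adjoint non-positive realisation
`A` on `Lp ℝ 2 (stdGaussian ℝ^d)` with core the temperate-growth classes, acting on them as `L`,
and `-A` has a spectral gap above its ground space at energy `0`, the image of the collision
invariants: the glue `hardSphereLinearizedOp_selfAdjointRealisation_of` fed with the discharged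
prelude facts `exists_isSelfAdjoint_hasCore_holds` (Grad's realisation `A = -ν + K`) and
`le_neg_maxwellianInner_hardSphereLinearizedOp_of_orthogonal_holds` (the quantitative gap) at
`E = ℝ^d`. [cite: CIP1994, §7.2 Thm 7.2.1 p. 197 and Thm 7.2.5 p. 201] -/
theorem hardSphereLinearizedOp_selfAdjointRealisation_holds :
    hardSphereLinearizedOp_selfAdjointRealisation (d := d) :=
  hardSphereLinearizedOp_selfAdjointRealisation_of
    Literature.Analysis.UnboundedOperators.exists_isSelfAdjoint_hasCore_holds
    Literature.Analysis.UnboundedOperators.le_neg_maxwellianInner_hardSphereLinearizedOp_of_orthogonal_holds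

end

end Literature.MathematicalPhysics.KineticTheory
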